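import Mathlib
import HarnessLib
import Summits.QuantumFields.YangMills.Theses.FradkinShenkerFlow
import Literature.MathematicalPhysics.QuantumFieldTheory.WilsonFlow
import Literature.MathematicalPhysics.QuantumFieldTheory.LatticeGaugeProofs

/-!
# Sketch — crux idea `flowed-witness-ir-slavery` (crux stmt-QuantumFields-9441,
`FradkinShenkerFlow.SusceptibilityToPoincare`), ideator k = 2, round 1.

First lemmas of the line, over existing declarations only:

* `UPWith r β C` — the conclusion of the crux at `(G, r, β)` with a named constant (verbatim shape).
* `up_boundedDifferences` — UP(C) turns the Wilson measure into an Efron–Stein/McDiarmid space for the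
  HEAT-BATH geometry: `Var F ≤ C Σ_ℓ osc_ℓ(F)²`. This is the interface by which ANY explicit family of
  bounded test functions `F_S` with `Σ_ℓ osc_ℓ(F_S)² → 0` and `Var F_S ≥ v₀ > 0` refutes UP(β), hence (given
  FS(β)) the crux. For flow times `≍ S²` the one-link response must be taken in MEAN SQUARE (the flow amplifies
  worst-case sensitivities near unstable saddles), i.e. one uses UP itself, `Var ≤ C·ℰ_hb`; the sup-norm form below is
  the handle for O(1) flow times / un-flowed smeared observables.
* `crux_boundedDifferences` — the same, extracted from the route decl `SusceptibilityToPoincare` by name.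
* `flowedWitness` — the gauge-invariant flowed (Lüscher gradient-flow) plaquette-energy witness family for
  `SU(n)`, typed over the tree's `wilsonFlow`; `flowedWitness_gaugeInvariant` (from `wilsonFlow_gaugeTransform`).
-/

open MeasureTheory ProbabilityTheory
open Literature.MathematicalPhysics.QuantumFieldTheory

namespace Summit.QuantumFields.YangMills.Cruxes.SusceptibilityToPoincare.FlowedWitness

section General

variable {G : Type} [Group G] [TopologicalSpace G] [IsTopologicalGroup G] [CompactSpace G]
  [MeasurableSpace G] [BorelSpace G]

/-- One heat-bath Dirichlet term of the route (verbatim shape): `∫∫ (F U − F(U[ℓ ↦ g]))² dν_ℓ^U(g) dμ_{β,S}(U)`. -/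
noncomputable def hbTerm (r : LatticeRep G) (β : ℝ) (S : ℕ)
    (F : GaugeConfig 4 (2 * S + 1) G → ℝ) (ℓ : Edge 4 (2 * S + 1)) : ℝ :=
  ∫ U, ∫ g, (F U - F (Function.update U ℓ g)) ^ 2
    ∂((haarProbability G).tilted (fun g' => -β * wilsonAction r.ρ (Function.update U ℓ g')))
    ∂(wilsonMeasure (d := 4) (L := 2 * S + 1) r.ρ β)

/-- UP(β) with a named constant `C`: the conclusion of `SusceptibilityToPoincare` at `(G, r, β)`. -/
def UPWith (r : LatticeRep G) (β : ℝ) (C : ℝ) : Prop :=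
  ∀ S : ℕ, ∀ F : GaugeConfig 4 (2 * S + 1) G → ℝ, Measurable F → (∃ M : ℝ, ∀ U, |F U| ≤ M) →
    ProbabilityTheory.variance F (wilsonMeasure (d := 4) (L := 2 * S + 1) r.ρ β) ≤
      C * ∑ ℓ : Edge 4 (2 * S + 1), hbTerm r β S F ℓ

/-- The finite gauge-invariant susceptibility hypothesis FS(β) of the crux at `(G, r, β)` (verbatim shape). -/
def FSAt (r : LatticeRep G) (β : ℝ) : Prop :=
  ∀ A B : YMSpecies G, ∃ χ : ℝ, ∀ S : ℕ, ∑ x ∈ Literature.Probability.LatticeModels.box 4 S,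
    |ProbabilityTheory.covariance
        (fun U => A.F (Literature.MathematicalPhysics.QuantumLattice.torusLift (2 * S + 1) U))
        (fun U => B.F (Literature.MathematicalPhysics.QuantumLattice.configShift (-x)
          (Literature.MathematicalPhysics.QuantumLattice.torusLift (2 * S + 1) U)))
        (wilsonMeasure (d := 4) (L := 2 * S + 1) r.ρ β)| ≤ χ

/-- The crux, read back: `SusceptibilityToPoincare` is literally `∀ G simple, r, β ≥ 0, FS → ∃ C, UP(C)`. -/
theorem crux_iff :
    Summit.QuantumFields.YangMills.Theses.FradkinShenkerFlow.SusceptibilityToPoincare ↔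
      ∀ (G : Type) [Group G] [TopologicalSpace G] [IsTopologicalGroup G] [CompactSpace G]
        [MeasurableSpace G] [BorelSpace G], IsCompactSimpleLieGroup G →
        ∀ (r : LatticeRep G) (β : ℝ), 0 ≤ β → FSAt r β → ∃ C : ℝ, UPWith r β C :=
  Iff.rfl

omit [IsTopologicalGroup G] [CompactSpace G] [BorelSpace G] in
/-- A probability measure tilted by any real function has total mass `≤ 1` (mass `1` if `exp ∘ f` is
integrable, the zero measure otherwise). -/
theorem tilted_univ_le_one {α : Type*} [MeasurableSpace α] (μ : Measure α) [IsProbabilityMeasure μ]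
    (f : α → ℝ) : μ.tilted f Set.univ ≤ 1 := by
  by_cases hf : Integrable (fun x => Real.exp (f x)) μ
  · haveI := isProbabilityMeasure_tilted hf
    simp
  · simp [tilted_of_not_integrable hf]

omit [IsTopologicalGroup G] [CompactSpace G] [BorelSpace G] in
/-- Elementary: a function with `0 ≤ f ≤ K` integrates to at most `K` against a measure of mass `≤ 1`. -/
theorem integral_le_of_le_of_measure_le_one {α : Type*} [MeasurableSpace α] {ν : Measure α}
    (hν : ν Set.univ ≤ 1) {f : α → ℝ} {K : ℝ} (hK : 0 ≤ K) (hf : ∀ x, f x ≤ K) :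
    ∫ x, f x ∂ν ≤ K := by
  by_cases hfi : Integrable f ν
  · haveI : IsFiniteMeasure ν := ⟨lt_of_le_of_lt hν ENNReal.one_lt_top⟩
    have h1 : ∫ x, f x ∂ν ≤ ∫ _x, K ∂ν := integral_mono hfi (integrable_const K) hf
    have h2 : ∫ _x, K ∂ν = ν.real Set.univ * K := by
      rw [integral_const, smul_eq_mul]
    have h3 : ν.real Set.univ ≤ 1 := by
      have := ENNReal.toReal_mono ENNReal.one_ne_top hν
      simpa [Measure.real] using this
    calc ∫ x, f x ∂ν ≤ ν.real Set.univ * K := h1.trans h2.le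
      _ ≤ 1 * K := by gcongr
      _ = K := one_mul K
  · simp [integral_undef hfi, hK]

/-- The Haar probability measure of the compact group `G` has total mass one. -/
theorem haarProbability_univ : (haarProbability G) Set.univ = 1 := by
  have h := Measure.haarMeasure_self (G := G) (K₀ := ⊤)
  simpa [haarProbability] using h

/-- **First lemma (bounded differences from UP).** If UP(β) holds with constant `C ≥ 0`, then for every
torus, every bounded measurable `F` and every family of one-link oscillation bounds
`|F U − F (U[ℓ ↦ g])| ≤ c ℓ`, one has `Var F ≤ C Σ_ℓ (c ℓ)²` — uniformly in `S`. Refutation interface: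
a family `F_S` with `Σ_ℓ c_ℓ² → 0` and `Var F_S ↛ 0` kills UP(β). -/
theorem up_boundedDifferences (r : LatticeRep G) (β C : ℝ) (hC : 0 ≤ C) (hUP : UPWith r β C)
    (S : ℕ) (F : GaugeConfig 4 (2 * S + 1) G → ℝ) (hF : Measurable F) (hb : ∃ M : ℝ, ∀ U, |F U| ≤ M)
    (c : Edge 4 (2 * S + 1) → ℝ) (hc : ∀ U ℓ g, |F U - F (Function.update U ℓ g)| ≤ c ℓ) :
    ProbabilityTheory.variance F (wilsonMeasure (d := 4) (L := 2 * S + 1) r.ρ β) ≤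
      C * ∑ ℓ : Edge 4 (2 * S + 1), (c ℓ) ^ 2 := by
  refine (hUP S F hF hb).trans ?_
  refine mul_le_mul_of_nonneg_left (Finset.sum_le_sum fun ℓ _ => ?_) hC
  -- `hbTerm ℓ ≤ (c ℓ)²`: both integrals are against measures of mass ≤ 1 and the integrand is ≤ (c ℓ)².
  have hcℓ : 0 ≤ (c ℓ) ^ 2 := sq_nonneg _
  haveI : IsProbabilityMeasure (haarProbability G) := ⟨haarProbability_univ⟩
  haveI := isProbabilityMeasure_wilsonMeasure (d := 4) (L := 2 * S + 1) r.ρ r.continuous β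
  have hinner : ∀ U : GaugeConfig 4 (2 * S + 1) G,
      ∫ g, (F U - F (Function.update U ℓ g)) ^ 2
        ∂((haarProbability G).tilted (fun g' => -β * wilsonAction r.ρ (Function.update U ℓ g')))
        ≤ (c ℓ) ^ 2 := fun U =>
    integral_le_of_le_of_measure_le_one (tilted_univ_le_one _ _) hcℓ fun g => by
      have h := hc U ℓ g
      have h0 : 0 ≤ |F U - F (Function.update U ℓ g)| := abs_nonneg _
      calc (F U - F (Function.update U ℓ g)) ^ 2 = |F U - F (Function.update U ℓ g)| ^ 2 := (sq_abs _).symm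
        _ ≤ (c ℓ) ^ 2 := pow_le_pow_left₀ h0 h 2
  unfold hbTerm
  exact integral_le_of_le_of_measure_le_one (by simp) hcℓ hinner

/-- The interface extracted from the route decl BY NAME: the crux hands every simple `G`, faithful `r`,
`β ≥ 0` with FS(β) a constant `C` for which the bounded-differences inequality holds on all tori. -/
theorem crux_boundedDifferences
    (h : Summit.QuantumFields.YangMills.Theses.FradkinShenkerFlow.SusceptibilityToPoincare)
    (hG : IsCompactSimpleLieGroup G) (r : LatticeRep G) (β : ℝ) (hβ : 0 ≤ β) (hFS : FSAt r β) :
    ∃ C : ℝ, 0 ≤ C ∧ ∀ (S : ℕ) (F : GaugeConfig 4 (2 * S + 1) G → ℝ), Measurable F →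
      (∃ M : ℝ, ∀ U, |F U| ≤ M) → ∀ c : Edge 4 (2 * S + 1) → ℝ,
      (∀ U ℓ g, |F U - F (Function.update U ℓ g)| ≤ c ℓ) →
      ProbabilityTheory.variance F (wilsonMeasure (d := 4) (L := 2 * S + 1) r.ρ β) ≤
        C * ∑ ℓ : Edge 4 (2 * S + 1), (c ℓ) ^ 2 := by
  obtain ⟨C, hC⟩ := (crux_iff.mp h) G hG r β hβ hFS
  refine ⟨max C 0, le_max_right _ _, fun S F hF hb c hc => ?_⟩
  have hUP' : UPWith r β (max C 0) := fun S F hF hb => (hC S F hF hb).trans <| by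
    refine mul_le_mul_of_nonneg_right (le_max_left _ _) (Finset.sum_nonneg fun ℓ _ => ?_)
    exact integral_nonneg fun U => integral_nonneg fun g => sq_nonneg _
  exact up_boundedDifferences r β (max C 0) (le_max_right _ _) hUP' S F hF hb c hc

end General

section Witness

/-! ### The flowed witness family (`G = SU(n)`), typed over the tree's `wilsonFlow` -/

local notation "SU[" n "]" => Matrix.specialUnitaryGroup (Fin n) ℂ

variable {n L : ℕ} [NeZero L]

/-- Flowed plaquette energy `n − Re tr V_t(U)_p` at flow time `t` (Lüscher's `E(t)` density up to
normalisation), a bounded measurable gauge-invariant observable for every `t ≥ 0`. -/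
noncomputable def flowedPlaquette (t : ℝ) (U : GaugeConfig 4 L SU[n]) (x : Site 4 L) (i j : Fin 4) : ℝ :=
  (n : ℝ) - (((plaquetteHolonomy (wilsonFlow t U) x i j : SU[n]) : Matrix (Fin n) (Fin n) ℂ).trace).re

/-- The smeared flowed witness `W_{t,φ}(U) = Σ_{x,i,j} φ(x,i,j) · (n − Re tr V_t(U)_{x,ij})` — for an
envelope `φ` at the torus scale and `t ≍ L²` this is the invariant slow-mode candidate of the card. -/
noncomputable def flowedWitness (t : ℝ) (φ : Site 4 L → Fin 4 → Fin 4 → ℝ) (U : GaugeConfig 4 L SU[n]) : ℝ :=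
  ∑ x : Site 4 L, ∑ i : Fin 4, ∑ j : Fin 4, φ x i j * flowedPlaquette t U x i j

/-- Gauge invariance of one flowed plaquette energy: `V_t(U^g) = V_t(U)^g` (`wilsonFlow_gaugeTransform`),
`(V^g)_p = g_x V_p g_x⁻¹` (`QuantumLattice.plaquetteHolonomy_gaugeTransform`) and cyclicity of the trace. -/
theorem flowedPlaquette_gaugeTransform (t : ℝ) (g : Site 4 L → SU[n]) (U : GaugeConfig 4 L SU[n])
    (x : Site 4 L) (i j : Fin 4) :
    flowedPlaquette t (gaugeTransform g U) x i j = flowedPlaquette t U x i j := by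
  unfold flowedPlaquette
  rw [wilsonFlow_gaugeTransform, Literature.MathematicalPhysics.QuantumLattice.plaquetteHolonomy_gaugeTransform,
    WilsonFlow.coe_mul_SU, WilsonFlow.coe_mul_SU, WilsonFlow.coe_inv_SU, Matrix.trace_mul_cycle,
    WilsonFlow.conjTranspose_mul_self_SU, Matrix.one_mul]

/-- Gauge invariance of the flowed witness (so it is a legitimate test function for UP_inv as well as UP). -/
theorem flowedWitness_gaugeInvariant (t : ℝ) (φ : Site 4 L → Fin 4 → Fin 4 → ℝ) :
    IsGaugeInvariant (flowedWitness (n := n) (L := L) t φ) := by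
  intro g U
  simp only [flowedWitness, flowedPlaquette_gaugeTransform]

end Witness

end Summit.QuantumFields.YangMills.Cruxes.SusceptibilityToPoincare.FlowedWitness
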